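import Summits.CriticalPhenomena.Ising3DConformalLimit.Theorems.FKParityRobustnessIndependentStrandsJoinCrossFatteningDefs
import Summits.CriticalPhenomena.Ising3DConformalLimit.Theorems.FKParityRobustnessLatticeBoundFromStrands
import Literature.Probability.LatticeModels.IsingExponents
import HarnessLib

/-!
# Crux `IndependentStrandsJoin` (stmt-CriticalPhenomena-14625), line `cross-fattening-decoupling` —
# stub `stub_treeFloor`, conditional on two-sided `η`-regularity of the critical two-point function

Route `FKParityRobustness`, sub-problem `Ising3DConformalLimit`; Stub 5 of the skeleton
`Cruxes/IndependentStrandsJoin/Lines/cross_fattening_decoupling.lean` (vocabulary `profile`, `window`, `zPair`: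
`Theorems/FKParityRobustnessIndependentStrandsJoinCrossFatteningDefs.lean`).  The registered stub: there is `c > 0`
such that for every `l ≥ 1`, all large `N` and the sources `a = l·tetra ⊂ Λ_N = box 3 N`
(`tetra = {(−1,−1,−1),(1,1,−1),(1,−1,1),(−1,1,1)}`), on `G_N = (zdGraph 3).comap Subtype.val` at `t = tanh β_c`,
`c·(Z^∅)²·Z^{a₀a₁}·Z^{a₂a₃} ≤ profile G_N t a (window N l) = Σ_{u ∈ B_l} Z(a₀u)Z(ua₁)Z(a₂u)Z(ua₃)`, `B_l = {2|uᵢ| ≤ l}`: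
dividing by `(Z^∅)⁴` (`⟨σ_xσ_y⟩^free_{Λ_N} = Z^{xy}/Z^∅`), the window-restricted tetrahedral TREE DIAGRAM is not small
against `⟨σ_{a₀}σ_{a₁}⟩⟨σ_{a₂}σ_{a₃}⟩`, uniformly in `l`.  Unconditionally this is an open two-point-function problem
(the rigorous envelope `c‖x‖⁻² ≤ τ_{β_c}(x) ≤ C‖x‖⁻¹` only gives `≥ c·l⁻³`); this file proves it CONDITIONALLY on the
named Literature fact `HasIsingEtaBounds 3 η` (`c‖x‖^{-(1+η)} ≤ τ_{β_c}(x) ≤ C‖x‖^{-(1+η)}`, Aizenman–Duminil-Copin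
2021, Assumption 4.1) with `η ≤ 1/2` — `stub_treeFloor_of_etaBounds` (registered sub-goal; `0 ≤ η` is forced by the
infrared bound, `StubTreeFloor.treeFloor_eta_nonneg`).

**Proof.**  STEP A (`ℤ³`, `treeFloor_core`/`treeFloor_lattice`): with `Aᵢ = l·tetra i`, `B_l = box 3 (l/2)`,
`τ = criticalTwoPoint 3`: window factors have `0 < ‖u − Aᵢ‖ ≤ 2l` so `τ ≥ c₁(2l)^{-(1+η)}`, `#B_l ≥ l³`, and
`‖A₁ − A₀‖, ‖A₃ − A₂‖ ≥ 2l` so pair factors are `≤ C(2l)^{-(1+η)}`; hence `Σ_{B_l} τ⁴ ≥ (c₁⁴/C²)·l³(2l)^{-2-2η}·τ(A₁−A₀)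
τ(A₃−A₂) ≥ (c₁⁴/(8C²))·τ(A₁−A₀)τ(A₃−A₂)` for `η ≤ 1/2` (the count `l^{1−2η} ≥ 1`).  STEP B (`treeFloor_transfer`): window
points are never sources (`2|(aᵢ)₀| = 2l > l`), so every `zPair` of the profile is a `Z^{xy}`, `x ≠ y`, equal to
`Z^∅·⟨σ_xσ_y⟩^free_{Λ_N,β_c}` (`twoPoint_eq_loopO1_div`, `twoPoint_boxComap`); re-indexing the window by `box 3 (l/2)`,
`profile = (Z^∅)⁴·T_N`, `(Z^∅)²Z^{a₀a₁}Z^{a₂a₃} = (Z^∅)⁴·R_N`, where the `#B_l + 2` free box two-point functions in `T_N, R_N`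
converge to `criticalCorr 3 2 ![x,y] = τ(y − x)` (`criticalCorr_wellDefined_holds`, `plusPair_eq_twoPointPlus_sub`); Step A
is the strict inequality `κ·lim R_N < lim T_N`, so `κ·R_N < T_N` for `N ≥ N₀(l)`, and `(Z^∅)⁴ > 0` gives the claim.

References: M. Aizenman, H. Duminil-Copin, Ann. of Math. 194 (2021), arXiv:1912.07973, §4 (Assumption 4.1,
Lemma 4.4) [AizenmanDuminilCopinAnnals2021]; H. Duminil-Copin, ICM 2022, §4.2.1 [DuminilCopinICM2022];
S. Friedli, Y. Velenik, *Statistical Mechanics of Lattice Systems*, CUP 2017, §3.7.3, Thm. 3.17 [FriedliVelenik2017];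
M. Aizenman, H. Duminil-Copin, V. Sidoravicius, CMP 334 (2015) [AizenmanDuminilCopinSidoraviciusCMP2015].
-/

noncomputable section

open Finset Filter Topology
open Literature.Probability.LatticeModels
open Summit.CriticalPhenomena.Ising3DConformalLimit.Cruxes.ParityRobustMerging.PlaquetteXorSurgery
  (tetra tetra_injective tanh_criticalBeta_nonneg)
open Summit.CriticalPhenomena.Ising3DConformalLimit.Cruxes.IndependentStrandsJoin.CrossFatteningDecoupling
open Summit.CriticalPhenomena.Ising3DConformalLimit.FKParityRobustnessLatticeBoundFromStrands
  (twoPoint_eq_loopO1_div twoPoint_boxComap twoPoint_eq_isingExpect_spinMonomial)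

namespace Summit.CriticalPhenomena.Ising3DConformalLimit.Theorems

namespace StubTreeFloor

/-! ### The tetrahedron and the window: sup-norm geometry of `ℤ³` -/
/-- Every coordinate of every vertex of the unit tetrahedron is `±1`. [folklore] -/
theorem treeFloor_abs_tetra (i : Fin 4) (j : Fin 3) : |tetra i j| = 1 := by
  fin_cases i <;> fin_cases j <;> decide

/-- The coordinates of the dilated vertices `l·tetra i` have absolute value `l`. [folklore] -/
theorem treeFloor_abs_smul_tetra (l : ℕ) (i : Fin 4) (j : Fin 3) : |((l : ℤ) • tetra i) j| = (l : ℤ) := by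
  rw [Pi.smul_apply, smul_eq_mul, abs_mul, treeFloor_abs_tetra, mul_one, Nat.abs_cast]

/-- A coordinatewise bound is a sup-norm bound on `ℤ³`. [folklore] -/
theorem treeFloor_norm_le {x : Site 3} {r : ℤ} (hr : 0 ≤ r) (h : ∀ j, |x j| ≤ r) : ‖x‖ ≤ ((r : ℤ) : ℝ) := by
  refine (pi_norm_le_iff_of_nonneg (by exact_mod_cast hr)).2 fun j => ?_
  rw [Int.norm_eq_abs, ← Int.cast_abs]
  exact_mod_cast h j

/-- A coordinate bounds the sup norm of `ℤ³` from below. [folklore] -/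
theorem treeFloor_abs_le_norm (x : Site 3) (j : Fin 3) : ((|x j| : ℤ) : ℝ) ≤ ‖x‖ := by
  have h := norm_le_pi_norm x j
  rwa [Int.norm_eq_abs, ← Int.cast_abs] at h

/-- Window points against the dilated vertices: for `u ∈ B_l = box 3 (l/2)` and `l ≥ 1`, `u − l·tetra i ≠ 0` and
`‖u − l·tetra i‖ ≤ 2l` (sup norm). [folklore] -/
theorem treeFloor_window_sub {l : ℕ} (hl : 1 ≤ l) {u : Site 3} (hu : u ∈ box 3 (l / 2)) (i : Fin 4) :
    u - (l : ℤ) • tetra i ≠ 0 ∧ ‖u - (l : ℤ) • tetra i‖ ≤ (2 * l : ℝ) := by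
  rw [mem_box] at hu
  constructor
  · intro h
    have h0 : u 0 = ((l : ℤ) • tetra i) 0 := by rw [← sub_eq_zero, ← Pi.sub_apply, h, Pi.zero_apply]
    have ha := treeFloor_abs_smul_tetra l i 0
    rw [← h0] at ha
    have h1 := hu 0
    rcases abs_cases (u 0) with ⟨h2, h3⟩ | ⟨h2, h3⟩ <;> omega
  · have key : ‖u - (l : ℤ) • tetra i‖ ≤ (((2 * l : ℕ) : ℤ) : ℝ) := by
      refine treeFloor_norm_le (by positivity) fun j => ?_
      rw [Pi.sub_apply]
      calc |u j - ((l : ℤ) • tetra i) j| ≤ |u j| + |((l : ℤ) • tetra i) j| := abs_sub _ _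
        _ = |u j| + l := by rw [treeFloor_abs_smul_tetra]
        _ ≤ ((2 * l : ℕ) : ℤ) := by
          have h1 := hu j
          rcases abs_cases (u j) with ⟨h2, h3⟩ | ⟨h2, h3⟩ <;> push_cast <;> omega
    exact_mod_cast key

/-- The pairs `{A₀,A₁}`, `{A₂,A₃}` of the dilated tetrahedron are at sup-distance `≥ 2l` (the first coordinate of
the difference is `±2l`). [folklore] -/
theorem treeFloor_pair_norm (l : ℕ) {a b : Fin 4} (hab : |tetra b 0 - tetra a 0| = 2) :
    (2 * l : ℝ) ≤ ‖(l : ℤ) • tetra b - (l : ℤ) • tetra a‖ := by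
  have h := treeFloor_abs_le_norm ((l : ℤ) • tetra b - (l : ℤ) • tetra a) 0
  have h2 : |((l : ℤ) • tetra b - (l : ℤ) • tetra a) 0| = 2 * l := by
    rw [Pi.sub_apply, Pi.smul_apply, Pi.smul_apply, smul_eq_mul, smul_eq_mul, ← mul_sub, abs_mul, hab,
      Nat.abs_cast, mul_comm]
  rw [h2] at h
  exact_mod_cast h

/-! ### Step A: the window tree sum on `ℤ³` under two-sided power bounds -/
/-- **Step A, core estimate.**  If `c₁‖x‖^{-p} ≤ τ(x) ≤ C‖x‖^{-p}` for `x ≠ 0` with `0 ≤ p`, `2p ≤ 3`, then for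
`l ≥ 1`, `Aᵢ = l·tetra i`, `B_l = box 3 (l/2)`: `2κ·τ(A₁−A₀)τ(A₃−A₂) ≤ Σ_{u ∈ B_l} τ(u−A₀)τ(A₁−u)τ(u−A₂)τ(A₃−u)`,
`κ = c₁⁴/(16C²)` — window factors `≥ c₁(2l)^{-p}` (`0 < ‖u − Aᵢ‖ ≤ 2l`), `#B_l ≥ l³`, pair factors `≤ C(2l)^{-p}`
(`‖A₁ − A₀‖ ≥ 2l`), and `l³(2l)^{-2p} ≥ l³(2l)^{-3} = 1/8`. [folklore] -/
theorem treeFloor_core {τ : Site 3 → ℝ} {p c₁ C : ℝ} (hp0 : 0 ≤ p) (hp3 : 2 * p ≤ 3) (hc₁ : 0 < c₁) (hC : 0 < C)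
    (hlow : ∀ x : Site 3, x ≠ 0 → c₁ * ‖x‖ ^ (-p) ≤ τ x) (hup : ∀ x : Site 3, x ≠ 0 → τ x ≤ C * ‖x‖ ^ (-p))
    (l : ℕ) (hl : 1 ≤ l) :
    2 * (c₁ ^ 4 / (16 * C ^ 2)) *
        (τ ((l : ℤ) • tetra 1 - (l : ℤ) • tetra 0) * τ ((l : ℤ) • tetra 3 - (l : ℤ) • tetra 2)) ≤
      ∑ u ∈ box 3 (l / 2), τ (u - (l : ℤ) • tetra 0) * τ ((l : ℤ) • tetra 1 - u) *
        (τ (u - (l : ℤ) • tetra 2) * τ ((l : ℤ) • tetra 3 - u)) := by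
  have hl1 : (1 : ℝ) ≤ l := by exact_mod_cast hl
  have hL1 : (1 : ℝ) ≤ 2 * l := by linarith
  have hL0 : (0 : ℝ) < 2 * l := by linarith
  -- lower bound at nonzero points of norm `≤ 2l`, upper bound at points of norm `≥ 2l`
  have hlowL : ∀ x : Site 3, x ≠ 0 → ‖x‖ ≤ 2 * l → c₁ * (2 * l : ℝ) ^ (-p) ≤ τ x := fun x hx hxL =>
    le_trans (mul_le_mul_of_nonneg_left
      (Real.rpow_le_rpow_of_nonpos (norm_pos_iff.2 hx) hxL (neg_nonpos.2 hp0)) hc₁.le) (hlow x hx)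
  have hupL : ∀ x : Site 3, (2 * l : ℝ) ≤ ‖x‖ → τ x ≤ C * (2 * l : ℝ) ^ (-p) := by
    intro x hxL
    have hx : x ≠ 0 := fun h => by rw [h, norm_zero] at hxL; linarith
    exact (hup x hx).trans
      (mul_le_mul_of_nonneg_left (Real.rpow_le_rpow_of_nonpos hL0 hxL (neg_nonpos.2 hp0)) hC.le)
  -- the two pair factors
  have h01 : τ ((l : ℤ) • tetra 1 - (l : ℤ) • tetra 0) ≤ C * (2 * l : ℝ) ^ (-p) :=
    hupL _ (treeFloor_pair_norm l (by decide))
  have h23 : τ ((l : ℤ) • tetra 3 - (l : ℤ) • tetra 2) ≤ C * (2 * l : ℝ) ^ (-p) :=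
    hupL _ (treeFloor_pair_norm l (by decide))
  have h23pos : 0 ≤ τ ((l : ℤ) • tetra 3 - (l : ℤ) • tetra 2) := by
    have hx : (l : ℤ) • tetra 3 - (l : ℤ) • tetra 2 ≠ 0 := fun h => by
      have h' := treeFloor_pair_norm l (a := 2) (b := 3) (by decide); rw [h, norm_zero] at h'; linarith
    exact le_trans (mul_nonneg hc₁.le (Real.rpow_nonneg (norm_nonneg _) _)) (hlow _ hx)
  have hprod : τ ((l : ℤ) • tetra 1 - (l : ℤ) • tetra 0) * τ ((l : ℤ) • tetra 3 - (l : ℤ) • tetra 2) ≤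
      (C * (2 * l : ℝ) ^ (-p)) * (C * (2 * l : ℝ) ^ (-p)) :=
    mul_le_mul h01 h23 h23pos (by positivity)
  -- each window term is `≥ (c₁(2l)^{-p})⁴`
  have hterm : ∀ u ∈ box 3 (l / 2),
      (c₁ * (2 * l : ℝ) ^ (-p)) ^ 4 ≤ τ (u - (l : ℤ) • tetra 0) * τ ((l : ℤ) • tetra 1 - u) *
        (τ (u - (l : ℤ) • tetra 2) * τ ((l : ℤ) • tetra 3 - u)) := by
    intro u hu
    have hcm : 0 ≤ c₁ * (2 * l : ℝ) ^ (-p) := by positivity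
    have g : ∀ i : Fin 4, c₁ * (2 * l : ℝ) ^ (-p) ≤ τ (u - (l : ℤ) • tetra i) ∧
        c₁ * (2 * l : ℝ) ^ (-p) ≤ τ ((l : ℤ) • tetra i - u) := by
      intro i
      obtain ⟨hne, hle⟩ := treeFloor_window_sub hl hu i
      refine ⟨hlowL _ hne hle, hlowL _ (sub_ne_zero.2 (sub_ne_zero.1 hne).symm) ?_⟩
      rwa [norm_sub_rev]
    calc (c₁ * (2 * l : ℝ) ^ (-p)) ^ 4
        = (c₁ * (2 * l : ℝ) ^ (-p)) * (c₁ * (2 * l : ℝ) ^ (-p)) *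
            ((c₁ * (2 * l : ℝ) ^ (-p)) * (c₁ * (2 * l : ℝ) ^ (-p))) := by ring
      _ ≤ τ (u - (l : ℤ) • tetra 0) * τ ((l : ℤ) • tetra 1 - u) *
            (τ (u - (l : ℤ) • tetra 2) * τ ((l : ℤ) • tetra 3 - u)) :=
          mul_le_mul (mul_le_mul (g 0).1 (g 1).2 hcm (hcm.trans (g 0).1))
            (mul_le_mul (g 2).1 (g 3).2 hcm (hcm.trans (g 2).1)) (by positivity)
            (mul_nonneg (hcm.trans (g 0).1) (hcm.trans (g 1).2))
  -- the window has at least `l³` points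
  have hcard : (l : ℝ) ^ 3 ≤ (#(box 3 (l / 2)) : ℝ) := by
    rw [card_box]
    push_cast
    have h : (l : ℝ) ≤ 2 * ((l / 2 : ℕ) : ℝ) + 1 := by exact_mod_cast (show l ≤ 2 * (l / 2) + 1 by omega)
    exact pow_le_pow_left₀ (by positivity) h 3
  -- exponent bookkeeping: `1/8 ≤ l³ · ((2l)^{-p})²`
  have h18 : (1 : ℝ) / 8 ≤ (l : ℝ) ^ 3 * ((2 * l : ℝ) ^ (-p)) ^ 2 := by
    have hm2 : ((2 * l : ℝ) ^ (-p)) ^ 2 = (2 * l : ℝ) ^ (-(2 * p)) := by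
      rw [sq, ← Real.rpow_add hL0, show -p + -p = -(2 * p) by ring]
    have h3 : (2 * l : ℝ) ^ (-(3 : ℝ)) ≤ (2 * l : ℝ) ^ (-(2 * p)) := Real.rpow_le_rpow_of_exponent_le hL1 (by linarith)
    have hL3 : (2 * l : ℝ) ^ (-(3 : ℝ)) = ((l : ℝ) ^ 3 * 8)⁻¹ := by rw [Real.rpow_neg hL0.le, Real.rpow_ofNat]; ring
    calc (1 : ℝ) / 8 = (l : ℝ) ^ 3 * ((l : ℝ) ^ 3 * 8)⁻¹ := by field_simp
      _ ≤ (l : ℝ) ^ 3 * ((2 * l : ℝ) ^ (-p)) ^ 2 := by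
        rw [hm2, ← hL3]
        exact mul_le_mul_of_nonneg_left h3 (by positivity)
  -- assemble
  calc 2 * (c₁ ^ 4 / (16 * C ^ 2)) *
        (τ ((l : ℤ) • tetra 1 - (l : ℤ) • tetra 0) * τ ((l : ℤ) • tetra 3 - (l : ℤ) • tetra 2))
      ≤ 2 * (c₁ ^ 4 / (16 * C ^ 2)) * ((C * (2 * l : ℝ) ^ (-p)) * (C * (2 * l : ℝ) ^ (-p))) :=
        mul_le_mul_of_nonneg_left hprod (by positivity)
    _ = (c₁ ^ 4 * ((2 * l : ℝ) ^ (-p)) ^ 2) * (1 / 8) := by field_simp; ring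
    _ ≤ (c₁ ^ 4 * ((2 * l : ℝ) ^ (-p)) ^ 2) * ((l : ℝ) ^ 3 * ((2 * l : ℝ) ^ (-p)) ^ 2) :=
        mul_le_mul_of_nonneg_left h18 (by positivity)
    _ = (l : ℝ) ^ 3 * (c₁ * (2 * l : ℝ) ^ (-p)) ^ 4 := by ring
    _ ≤ (#(box 3 (l / 2)) : ℝ) * (c₁ * (2 * l : ℝ) ^ (-p)) ^ 4 := mul_le_mul_of_nonneg_right hcard (by positivity)
    _ ≤ ∑ u ∈ box 3 (l / 2), τ (u - (l : ℤ) • tetra 0) * τ ((l : ℤ) • tetra 1 - u) *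
          (τ (u - (l : ℤ) • tetra 2) * τ ((l : ℤ) • tetra 3 - u)) := by
        have h := Finset.card_nsmul_le_sum (box 3 (l / 2)) _ _ hterm
        rwa [nsmul_eq_mul] at h

/-- **Step A on `ℤ³`.**  Under `HasIsingEtaBounds 3 η` with `0 ≤ η ≤ 1/2` there is `κ > 0` with, for every `l ≥ 1`
(`Aᵢ = l·tetra i`, `B_l = box 3 (l/2)`, `τ = criticalTwoPoint 3`),
`κ·τ(A₁−A₀)τ(A₃−A₂) < Σ_{u∈B_l} τ(u−A₀)τ(A₁−u)τ(u−A₂)τ(A₃−u)` (`treeFloor_core` gives `2κ ≤`, and the pair product is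
positive).  Cf. Aizenman–Duminil-Copin, Ann. of Math. 194 (2021), §4, Assumption 4.1. [folklore] -/
theorem treeFloor_lattice {η : ℝ} (hη : HasIsingEtaBounds 3 η) (hη0 : 0 ≤ η) (hη2 : η ≤ 1 / 2) :
    ∃ κ : ℝ, 0 < κ ∧ ∀ l : ℕ, 1 ≤ l →
      κ * (criticalTwoPoint 3 ((l : ℤ) • tetra 1 - (l : ℤ) • tetra 0) *
          criticalTwoPoint 3 ((l : ℤ) • tetra 3 - (l : ℤ) • tetra 2)) <
        ∑ u ∈ box 3 (l / 2), criticalTwoPoint 3 (u - (l : ℤ) • tetra 0) * criticalTwoPoint 3 ((l : ℤ) • tetra 1 - u) *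
          (criticalTwoPoint 3 (u - (l : ℤ) • tetra 2) * criticalTwoPoint 3 ((l : ℤ) • tetra 3 - u)) := by
  obtain ⟨c₁, C₁, hc₁, hb⟩ := hη
  set p : ℝ := ((3 : ℕ) : ℝ) - 2 + η with hp
  have hp0 : 0 ≤ p := by rw [hp]; push_cast; linarith
  have hp3 : 2 * p ≤ 3 := by rw [hp]; push_cast; linarith
  set C : ℝ := max C₁ 1 with hC
  have hC0 : 0 < C := lt_of_lt_of_le one_pos (le_max_right _ _)
  have hlow : ∀ x : Site 3, x ≠ 0 → c₁ * ‖x‖ ^ (-p) ≤ criticalTwoPoint 3 x := fun x hx => (hb x hx).1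
  have hup : ∀ x : Site 3, x ≠ 0 → criticalTwoPoint 3 x ≤ C * ‖x‖ ^ (-p) := fun x hx =>
    (hb x hx).2.trans (mul_le_mul_of_nonneg_right (le_max_left _ _) (Real.rpow_nonneg (norm_nonneg _) _))
  refine ⟨c₁ ^ 4 / (16 * C ^ 2), by positivity, fun l hl => ?_⟩
  have hcore := treeFloor_core hp0 hp3 hc₁ hC0 hlow hup l hl
  have hpos : ∀ x : Site 3, x ≠ 0 → 0 < criticalTwoPoint 3 x := fun x hx =>
    lt_of_lt_of_le (mul_pos hc₁ (Real.rpow_pos_of_pos (norm_pos_iff.2 hx) _)) (hlow x hx)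
  have hl1 : (1 : ℝ) ≤ l := by exact_mod_cast hl
  have hne : ∀ {a b : Fin 4}, |tetra b 0 - tetra a 0| = 2 → (l : ℤ) • tetra b - (l : ℤ) • tetra a ≠ 0 :=
    fun hab h => by have h1 := treeFloor_pair_norm l hab; rw [h, norm_zero] at h1; linarith
  have hP : 0 < c₁ ^ 4 / (16 * C ^ 2) * (criticalTwoPoint 3 ((l : ℤ) • tetra 1 - (l : ℤ) • tetra 0) *
      criticalTwoPoint 3 ((l : ℤ) • tetra 3 - (l : ℤ) • tetra 2)) :=
    mul_pos (by positivity) (mul_pos (hpos _ (hne (by decide))) (hpos _ (hne (by decide))))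
  linarith

/-- **`η ≥ 0` is forced**: `c₁‖x‖^{-(1+η)} ≤ τ_{β_c}(x)` is incompatible with the infrared bound `τ_{β_c}(x) ≤ C‖x‖⁻¹`
(`criticalTwoPoint_bounds_holds`, `d = 3`) unless `η ≥ 0`: along `x_n = (n,n,n)` (`‖x_n‖ = n`) one would get
`c₁ n^{-η} ≤ C` while `n^{-η} → ∞` for `η < 0`. [folklore] -/
theorem treeFloor_eta_nonneg {η : ℝ} (hη : HasIsingEtaBounds 3 η) : 0 ≤ η := by
  by_contra hneg
  rw [not_le] at hneg
  obtain ⟨c₁, C₁, hc₁, hb⟩ := hη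
  obtain ⟨c, C, hc, hbd⟩ := criticalTwoPoint_bounds_holds (d := 3) le_rfl
  have hnorm : ∀ n : ℕ, ‖(fun _ => (n : ℤ) : Site 3)‖ = n := by
    refine fun n => le_antisymm ?_ ?_
    · have h := treeFloor_norm_le (x := fun _ => (n : ℤ)) (r := n) (by positivity) (fun j => by rw [Nat.abs_cast])
      exact_mod_cast h
    · have h := treeFloor_abs_le_norm (fun _ => (n : ℤ) : Site 3) 0
      rw [Nat.abs_cast] at h
      exact_mod_cast h
  -- for `n ≥ 1`: `c₁ n^{-η} ≤ C`
  have hbound : ∀ n : ℕ, 1 ≤ n → c₁ * (n : ℝ) ^ (-η) ≤ C := by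
    intro n hn
    have hx : (fun _ => (n : ℤ) : Site 3) ≠ 0 := fun h => by
      have h0 := congrFun h 0; simp only [Pi.zero_apply, Nat.cast_eq_zero] at h0; omega
    have h1 := (hb _ hx).1
    have h2 := (hbd _ hx).2
    rw [hnorm] at h1 h2
    have hn0 : (0 : ℝ) < n := by exact_mod_cast hn
    rw [show -(((3 : ℕ) : ℝ) - 2 + η) = -η + (-1) by push_cast; ring, Real.rpow_add hn0, Real.rpow_neg_one] at h1
    rw [show -(((3 : ℕ) : ℝ) - 2) = -1 by push_cast; ring, Real.rpow_neg_one] at h2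
    have h3 : c₁ * (n : ℝ) ^ (-η) * (n : ℝ)⁻¹ ≤ C * (n : ℝ)⁻¹ := by rw [mul_assoc]; exact h1.trans h2
    exact le_of_mul_le_mul_right h3 (inv_pos.2 hn0)
  -- but `c₁ n^{-η} → ∞`
  have ht : Tendsto (fun n : ℕ => c₁ * (n : ℝ) ^ (-η)) atTop atTop :=
    Tendsto.const_mul_atTop hc₁ ((tendsto_rpow_atTop (by linarith)).comp tendsto_natCast_atTop_atTop)
  obtain ⟨n, hgt, hge⟩ := ((ht.eventually_gt_atTop C).and (eventually_ge_atTop 1)).exists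
  exact absurd (hbound n hge) (not_le.2 hgt)

section StepB

open scoped Classical symmDiff

/-- The free box two-point functions at `β_c` converge to the critical two-point function,
`⟨σ_xσ_y⟩^free_{Λ_N,β_c} → criticalCorr 3 2 ![x,y] = ⟨σ₀σ_{y−x}⟩⁺_{β_c}` (`criticalCorr_wellDefined_holds`, `d = 3`, and
translation invariance of the plus state `plusPair_eq_twoPointPlus_sub`; Friedli–Velenik 2017, Thm. 3.17). [folklore] -/
theorem treeFloor_tendsto_pair (x y : Site 3) :
    Tendsto (fun N : ℕ => isingExpect (zdGraph 3) (box 3 N) (criticalBeta 3) 0 .free (spinMonomial ![x, y])) atTop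
      (𝓝 (criticalTwoPoint 3 (y - x))) := by
  -- `criticalCorr 3 2 ![x, y] = τ(y − x)`, adapted from `criticalCorr_two_pair`
  -- (Literature/Probability/LatticeModels/HighDimPointwiseTriviality.lean)
  have h1 : criticalCorr 3 2 ![x, y] = criticalTwoPoint 3 (y - x) := by
    show _ = twoPointPlus 3 (criticalBeta 3) (y - x)
    rw [← plusPair_eq_twoPointPlus_sub (criticalBeta_nonneg 3)]
    change plusExpect 3 (criticalBeta 3) 0 (spinMonomial ![x, y]) = plusExpect 3 (criticalBeta 3) 0 (spinPair x y)
    congr 1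
    funext s
    simp [spinMonomial, spinPair, Fin.prod_univ_two]
  have h := criticalCorr_wellDefined_holds (d := 3) le_rfl 2 ![x, y] .free (by simp)
  rw [h1] at h
  exact h

/-- On the induced box graph, `Z^{xy}_N = Z^∅_N · ⟨σ_xσ_y⟩^free_{Λ_N,β_c}` for `x ≠ y` (high-temperature expansion
`twoPoint_eq_loopO1_div` transported by `twoPoint_boxComap`; Friedli–Velenik 2017, §3.7.3). [folklore] -/
theorem treeFloor_pair_eq {N : ℕ} {x y : ↥(box 3 N)} (hxy : x ≠ y) :
    loopO1PartitionFunction ((zdGraph 3).comap (Subtype.val : ↥(box 3 N) → Site 3)) (Real.tanh (criticalBeta 3)) {x, y} =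
      loopO1PartitionFunction ((zdGraph 3).comap (Subtype.val : ↥(box 3 N) → Site 3)) (Real.tanh (criticalBeta 3)) ∅ *
        isingExpect (zdGraph 3) (box 3 N) (criticalBeta 3) 0 .free (spinMonomial ![(x : Site 3), (y : Site 3)]) := by
  have hZ0 : 0 < loopO1PartitionFunction ((zdGraph 3).comap (Subtype.val : ↥(box 3 N) → Site 3))
      (Real.tanh (criticalBeta 3)) ∅ := loopO1PartitionFunction_empty_pos _ tanh_criticalBeta_nonneg
  have h := twoPoint_eq_loopO1_div (G := (zdGraph 3).comap (Subtype.val : ↥(box 3 N) → Site 3))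
    (criticalBeta_nonneg 3) hxy
  rw [twoPoint_boxComap (box 3 N) (criticalBeta 3) x y, twoPoint_eq_isingExpect_spinMonomial] at h
  rw [h, mul_div_cancel₀ _ hZ0.ne']

/-- Re-indexing the window: for `l ≤ N` the central window `{u ∈ Λ_N : 2|uᵢ| ≤ l}` of the box is in value-bijection
with `box 3 (l/2) ⊂ ℤ³`. [folklore] -/
theorem treeFloor_sum_window {N l : ℕ} (hlN : l ≤ N)
    [DecidablePred (fun u : ↥(box 3 N) => ∀ i, 2 * |((u : Site 3) i)| ≤ (l : ℤ))] (F : Site 3 → ℝ) :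
    ∑ u ∈ Finset.univ.filter (fun u : ↥(box 3 N) => ∀ i, 2 * |((u : Site 3) i)| ≤ (l : ℤ)), F (u : Site 3) =
      ∑ v ∈ box 3 (l / 2), F v := by
  have key : (Finset.univ.filter (fun u : ↥(box 3 N) => ∀ i, 2 * |((u : Site 3) i)| ≤ (l : ℤ))).map
      (Function.Embedding.subtype _) = box 3 (l / 2) := by
    ext v
    simp only [Finset.mem_map, Finset.mem_filter, Finset.mem_univ, true_and, Function.Embedding.coe_subtype, mem_box]
    constructor
    · rintro ⟨u, hu, rfl⟩ i
      have h1 := hu i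
      rcases abs_cases ((u : Site 3) i) with ⟨h2, h3⟩ | ⟨h2, h3⟩ <;> omega
    · intro hv
      refine ⟨⟨v, mem_box.2 fun i => ?_⟩, fun i => ?_, rfl⟩
      · have h1 := hv i
        omega
      · have h1 := hv i
        show 2 * |v i| ≤ (l : ℤ)
        rcases abs_cases (v i) with ⟨h2, h3⟩ | ⟨h2, h3⟩ <;> omega
  rw [← key, Finset.sum_map]
  rfl

/-- **Box transfer.**  From the strict lattice inequality of Step A (any `κ`), the registered box inequality with
`c = κ` for `N ≥ N₀(l)`: window points are never sources, `Z^{xy} = Z^∅⟨σ_xσ_y⟩^free` (`treeFloor_pair_eq`), the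
`#B_l + 2` free box two-point functions converge (`treeFloor_tendsto_pair`), and a strict inequality between the limits
holds eventually (`Filter.Tendsto.eventually_lt`). [folklore] -/
theorem treeFloor_transfer {κ : ℝ} {l : ℕ} (hl : 1 ≤ l)
    (hA : κ * (criticalTwoPoint 3 ((l : ℤ) • tetra 1 - (l : ℤ) • tetra 0) *
        criticalTwoPoint 3 ((l : ℤ) • tetra 3 - (l : ℤ) • tetra 2)) <
      ∑ u ∈ box 3 (l / 2), criticalTwoPoint 3 (u - (l : ℤ) • tetra 0) * criticalTwoPoint 3 ((l : ℤ) • tetra 1 - u) *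
        (criticalTwoPoint 3 (u - (l : ℤ) • tetra 2) * criticalTwoPoint 3 ((l : ℤ) • tetra 3 - u))) :
    ∃ N₀ : ℕ, ∀ N : ℕ, N₀ ≤ N → ∀ a : Fin 4 → ↥(box 3 N), (∀ i, ((a i : Site 3)) = (l : ℤ) • tetra i) →
      κ * (loopO1PartitionFunction ((zdGraph 3).comap (Subtype.val : ↥(box 3 N) → Site 3)) (Real.tanh (criticalBeta 3)) ∅ ^ 2 *
          loopO1PartitionFunction ((zdGraph 3).comap (Subtype.val : ↥(box 3 N) → Site 3)) (Real.tanh (criticalBeta 3))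
            {a 0, a 1} *
          loopO1PartitionFunction ((zdGraph 3).comap (Subtype.val : ↥(box 3 N) → Site 3)) (Real.tanh (criticalBeta 3))
            {a 2, a 3}) ≤
        profile ((zdGraph 3).comap (Subtype.val : ↥(box 3 N) → Site 3)) (Real.tanh (criticalBeta 3)) a (window N l) := by
  have hg := treeFloor_tendsto_pair
  -- the pair product and the window tree sum of the free box two-point functions converge (`N → ∞`)
  have hR := ((hg ((l : ℤ) • tetra 0) ((l : ℤ) • tetra 1)).mul (hg ((l : ℤ) • tetra 2) ((l : ℤ) • tetra 3))).const_mul κ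
  have hT := tendsto_finsetSum (box 3 (l / 2)) fun u _ =>
    ((hg ((l : ℤ) • tetra 0) u).mul (hg u ((l : ℤ) • tetra 1))).mul ((hg ((l : ℤ) • tetra 2) u).mul (hg u ((l : ℤ) • tetra 3)))
  obtain ⟨N₁, hN₁⟩ := eventually_atTop.1 (hR.eventually_lt hT hA)
  refine ⟨max N₁ l, fun N hN a ha => ?_⟩
  have hlN : l ≤ N := le_of_max_le_right hN
  have hZ0 : 0 < loopO1PartitionFunction ((zdGraph 3).comap (Subtype.val : ↥(box 3 N) → Site 3))
      (Real.tanh (criticalBeta 3)) ∅ := loopO1PartitionFunction_empty_pos _ tanh_criticalBeta_nonneg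
  have hainj : Function.Injective a := tetra_injective hl a ha
  -- window points are never sources
  have hwin : ∀ u ∈ window N l, ∀ i, u ≠ a i := by
    intro u hu i h
    have hu' := (Finset.mem_filter.1 hu).2 0
    rw [h, ha i, treeFloor_abs_smul_tetra] at hu'
    omega
  -- Step A at volume `N ≥ N₁`, times `(Z^∅)⁴ > 0`, re-indexed over the window
  have key := mul_lt_mul_of_pos_left (hN₁ N (le_of_max_le_left hN)) (pow_pos hZ0 4)
  rw [Finset.mul_sum, ← treeFloor_sum_window hlN] at key
  unfold profile window
  refine (lt_of_eq_of_lt ?_ (lt_of_lt_of_eq key (Finset.sum_congr rfl fun u hu => ?_))).le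
  · rw [treeFloor_pair_eq (hainj.ne (by decide : (0 : Fin 4) ≠ 1)),
      treeFloor_pair_eq (hainj.ne (by decide : (2 : Fin 4) ≠ 3)), ha 0, ha 1, ha 2, ha 3]
    ring
  · obtain ⟨h0, h1, h2, h3⟩ : u ≠ a 0 ∧ u ≠ a 1 ∧ u ≠ a 2 ∧ u ≠ a 3 :=
      ⟨hwin u hu 0, hwin u hu 1, hwin u hu 2, hwin u hu 3⟩
    unfold zPair
    rw [Current.symmDiff_singleton_eq_pair h0.symm, Current.symmDiff_singleton_eq_pair h1,
      Current.symmDiff_singleton_eq_pair h2.symm, Current.symmDiff_singleton_eq_pair h3,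
      treeFloor_pair_eq h0.symm, treeFloor_pair_eq h1, treeFloor_pair_eq h2.symm, treeFloor_pair_eq h3,
      ha 0, ha 1, ha 2, ha 3]
    ring

end StepB

end StubTreeFloor

/-- **Registered sub-goal `stub_treeFloor_of_etaBounds`: stub `stub_treeFloor` of the line `cross-fattening-decoupling`
(crux `IndependentStrandsJoin`, stmt-CriticalPhenomena-14625) CONDITIONAL on two-sided `η`-regularity of the critical
two-point function** — `HasIsingEtaBounds 3 η` (Aizenman–Duminil-Copin 2021, Assumption 4.1; an open two-point
problem) with `η ≤ 1/2` implies the registered statement verbatim: for `a = l·tetra ⊂ Λ_N` and the central window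
`B_l`, `c·(Z^∅)²Z^{a₀a₁}Z^{a₂a₃} ≤ Σ_{u∈B_l} Z(a₀u)Z(ua₁)Z(a₂u)Z(ua₃)` with `c` independent of `l`, `N ≥ N₀(l)`
(`treeFloor_eta_nonneg`, `treeFloor_lattice`, `treeFloor_transfer`). -/
theorem stub_treeFloor_of_etaBounds :
    ∀ η : ℝ, HasIsingEtaBounds 3 η → η ≤ 1 / 2 →
      ∃ c : ℝ, 0 < c ∧ ∀ l : ℕ, 1 ≤ l → ∃ N₀ : ℕ, ∀ N : ℕ, N₀ ≤ N → ∀ a : Fin 4 → ↥(box 3 N),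
        (∀ i, ((a i : Site 3)) = (l : ℤ) • tetra i) →
        (let G := ((zdGraph 3).comap (Subtype.val : ↥(box 3 N) → Site 3));
         let t : ℝ := Real.tanh (criticalBeta 3);
         c * (loopO1PartitionFunction G t ∅ ^ 2 * loopO1PartitionFunction G t {a 0, a 1} *
             loopO1PartitionFunction G t {a 2, a 3}) ≤ profile G t a (window N l)) := by
  intro η hη hη2
  obtain ⟨κ, hκ, hA⟩ := StubTreeFloor.treeFloor_lattice hη (StubTreeFloor.treeFloor_eta_nonneg hη) hη2
  exact ⟨κ, hκ, fun l hl => StubTreeFloor.treeFloor_transfer hl (hA l hl)⟩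

end Summit.CriticalPhenomena.Ising3DConformalLimit.Theorems

end
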